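import Summits.QuantumAdvantage.QuantumAdvantage.Theses.ArithStatLadder
import Summits.QuantumAdvantage.QuantumAdvantage.Theorems.ArithStatLadderIqThreeNotPPolyRURClosure
import Summits.QuantumAdvantage.QuantumAdvantage.Theorems.ArithStatLadderIqThreeNotPPolyStubNatAdapter
import Summits.QuantumAdvantage.QuantumAdvantage.Theorems.ArithStatLadderIqThreeNotPPolyStubSamplerAP
import Summits.QuantumAdvantage.QuantumAdvantage.Theorems.ArithStatLadderIqThreeNotPPolyStubOneSidedAP
import Summits.QuantumAdvantage.QuantumAdvantage.Theorems.ArithStatLadderIqThreeNotPPolyStubApSieve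
import Summits.QuantumAdvantage.QuantumAdvantage.Theorems.ArithStatLadderIqThreeNotPPolyStubFundDensityAP
import Summits.QuantumAdvantage.QuantumAdvantage.Theorems.ArithStatLadderIqThreeNotPPolyStubCubicFieldAP
import Literature.NumberTheory.CubicFields.ThreeTorsionBridge
import Literature.Computability.Cryptography.HallgrenClassGroup
import Literature.Computability.Complexity.StackWords

/-!
# Crux `ArithStatLadder.IqThreeNotPPoly` (stmt-QuantumAdvantage-2422): SQUAREFREE-FILTER DOMINATION

The conclusion of the line `Sketch` (lead `prover-line-stmt-QuantumAdvantage-2422-0`):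

* `toLanguage_squarefree_mem_PPoly_of_iqThree` — **`IQ3 ∈ P/poly → SQUAREFREES ∈ P/poly`**, modulo
  Hasse's class-field-theoretic dictionary, taken as an explicit hypothesis whose text is VERBATIM the
  body of the named fact `Literature.NumberTheory.CubicFields.Hasse1930_threeTorsion_dictionary_neg`
  (`HasseThreeTorsionDictionary.lean`, landed p91325; apply these theorems to `h : Hasse1930_…` as is)
  and the inline hypothesis `hCFT` of `ThreeTorsionBridge`: a ONE-SIDED
  randomized polynomial-time reduction `SQF ≤ IQ3` with success `≥ 1/8`, composed with the closure of
  `P/poly` under such reductions (`mem_PPoly_of_rurReduction`, `…RURClosure.lean`);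
* `iqThreeNotPPoly_of_squarefree_not_mem_PPoly` — **the crux `IqThreeNotPPoly` follows from
  "SQUAREFREES ∉ P/poly"** (hypothesis-type apex of the factoring family: Adleman–McCurley's open
  problem O8 in the non-uniform setting) and Hasse's dictionary: a CONDITIONAL theorem about the
  route decl, by name;
* `toLanguage_squarefree_mem_PPoly_of_not_iqThreeNotPPoly` — the refutation floor: any refutation of
  the crux puts SQUAREFREES in `P/poly` (given the dictionary).

The reduction (all landed as stubs of the line): on a numeral `x = bin N` and a seed `r`, `k = ⟦r⟧`,
put `t = 1 + 2Nk` and output `bin (N t (27 N t − 4))` — the absolute discriminant of the binary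
cubic form `x³ − x²y + N t·y³` (`stub_samplerAP`: the map is in `FP`; `stub_natAdapter`: guard
non-numerals). NO side, exact: `N` not squarefree ⇒ `p² ∣ N ⇒ p² ∣ d` (`16 ∣ d` at `p = 2`) ⇒ `−d`
is never fundamental (`stub_oneSidedAP`). YES side: for squarefree `N` of bit-length `n ≥ n₀`, at
least `1/8` of the `k < 2^{4n+8}` give a fundamental `−d` (`stub_fundDensityAP`, from the elementary
squarefree sieve in arithmetic progressions `stub_apSieve`); then the form is irreducible and defines
a cubic field of discriminant exactly `−d` (`stub_cubicFieldAP`, Delone–Faddeev), so `3 ∣ h(−d)` by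
Hasse's dictionary (`three_dvd_classNumber_of_one_le_cubicFieldCountOfDisc`), i.e. `d ∈ S`.
Theorems only; the two hypotheses are a published theorem (named fact) and the explicit apex.
-/

set_option linter.dupNamespace false -- D-0017: single-problem summit ⇒ `QuantumAdvantage.QuantumAdvantage` by design

noncomputable section

namespace Summit.QuantumAdvantage.QuantumAdvantage.Theorems.IqThreeNotPPoly

open scoped Classical
open _root_.Computability Literature.Computability.Complexity
open Literature.Computability.Cryptography (IsNegFundamentalDiscr)
open Literature.NumberTheory.QuadraticFields (BinaryQuadraticForm.classNumber)
open Literature.NumberTheory.CubicFields (cubicFieldCountOfDisc)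
open Literature.NumberTheory.QuadraticFields (negFundDiscrs mem_negFundDiscrs quadFieldThreeTorsion
  three_dvd_classNumber_iff_one_lt_quadFieldThreeTorsion)
open Summit.QuantumAdvantage.QuantumAdvantage.Theses.ArithStatLadder (IqThreeNotPPoly)

/-! ### Seeds and numerals -/

/-- **Seeds ↔ numbers**: counting seeds `r ∈ {0,1}^ℓ` by a property of their value `⟦r⟧` is counting
`k < 2^ℓ` (little-endian value is a bijection onto `[0, 2^ℓ)`). [folklore] -/
theorem card_filter_seeds (ℓ : ℕ) (P : ℕ → Prop) :
    (Finset.univ.filter (fun r : Fin ℓ → Bool => P (bitsToNat (List.ofFn r)))).card =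
      ((Finset.range (2 ^ ℓ)).filter (fun k => P k)).card := by
  let φ : (Fin ℓ → Bool) → ℕ := fun r => bitsToNat (List.ofFn r)
  have hφinj : Function.Injective φ := by
    intro r r' h
    have hlen : (List.ofFn r).length = ℓ := List.length_ofFn
    have hlen' : (List.ofFn r').length = ℓ := List.length_ofFn
    exact List.ofFn_injective (bitsToNat_injOn_length ℓ hlen hlen' h)
  have himg : (Finset.univ : Finset (Fin ℓ → Bool)).image φ = Finset.range (2 ^ ℓ) := by
    apply Finset.eq_of_subset_of_card_le
    · intro k hk
      obtain ⟨r, -, rfl⟩ := Finset.mem_image.1 hk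
      rw [Finset.mem_range]
      have h := bitsToNat_lt (List.ofFn r)
      rwa [List.length_ofFn] at h
    · rw [Finset.card_range, Finset.card_image_of_injective _ hφinj, Finset.card_univ,
        Fintype.card_fun, Fintype.card_bool, Fintype.card_fin]
  have hfilter : Finset.univ.filter (fun r : Fin ℓ → Bool => P (bitsToNat (List.ofFn r))) =
      Finset.univ.filter (fun r : Fin ℓ → Bool => P (φ r)) := rfl
  rw [hfilter, ← himg, Finset.filter_image, Finset.card_image_of_injective _ hφinj]

/-- Membership of a numeral in the language of a set of numbers (the tree's
`Encoding.mem_toLanguage_iff`, restated with Mathlib's `encodeNat` on the left so that `rw` finds it).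
[folklore] -/
theorem encodeNat_mem_toLanguage_iff (S : Set ℕ) (a : ℕ) :
    encodeNat a ∈ encodingNatBool.toLanguage S ↔ a ∈ S :=
  encodingNatBool.mem_toLanguage_iff S a

/-- `−0` is not a fundamental discriminant. [folklore] -/
theorem not_isNegFundamentalDiscr_zero : ¬ IsNegFundamentalDiscr 0 := by
  intro h
  rcases h with ⟨h1, -, -⟩ | ⟨-, h2, -⟩
  · norm_num at h1
  · norm_num at h2

/-- The empty word (the numeral of `0`) is not in `IQ3`. [folklore] -/
theorem nil_not_mem_iqThreeLanguage : ([] : List Bool) ∉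
    encodingNatBool.toLanguage
      {d : ℕ | IsNegFundamentalDiscr d ∧ 3 ∣ BinaryQuadraticForm.classNumber (-(d : ℤ))} := by
  rintro ⟨d, hd, hd0⟩
  change encodeNat d = [] at hd0
  have h := congrArg decodeNat hd0
  rw [decode_encodeNat] at h
  have h0 : d = 0 := h.trans (by decide)
  subst h0
  exact not_isNegFundamentalDiscr_zero hd.1

/-- **Hasse's direction from the dictionary**: a cubic field of negative fundamental discriminant `D`
forces `3 ∣ h(D)` (`#Cl₃(D) = 2c + 1 ≥ 3 > 1` and `3 ∣ h(D) ↔ 1 < #Cl₃(D)`,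
`three_dvd_classNumber_iff_one_lt_quadFieldThreeTorsion`). The hypothesis is verbatim the named fact
`Hasse1930_threeTorsion_dictionary_neg` (the same corollary is filed next to it as
`three_dvd_classNumber_of_one_le_cubicFieldCountOfDisc`). [folklore] -/
theorem three_dvd_classNumber_of_threeTorsion_dictionary
    (hH : ∀ X : ℕ, ∀ D ∈ negFundDiscrs X, quadFieldThreeTorsion D = 2 * cubicFieldCountOfDisc D + 1)
    {D : ℤ}
    (hD : (D % 4 = 1 ∧ Squarefree D ∧ D ≠ 1) ∨
      (4 ∣ D ∧ (D / 4 % 4 = 2 ∨ D / 4 % 4 = 3) ∧ Squarefree (D / 4)))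
    (hD0 : D < 0) (hc : 1 ≤ cubicFieldCountOfDisc D) :
    3 ∣ BinaryQuadraticForm.classNumber D := by
  have hmem : D ∈ negFundDiscrs (D.natAbs + 1) := by
    rw [mem_negFundDiscrs]
    refine ⟨⟨?_, hD0⟩, hD⟩
    omega
  have ht := hH (D.natAbs + 1) D hmem
  rw [three_dvd_classNumber_iff_one_lt_quadFieldThreeTorsion hD hD0, ht]
  omega

/-- **Hasse's step**: for squarefree `N` a seed value `k` with fundamental `−d`,
`d = N t (27Nt − 4)`, lands in `S` — a cubic field of discriminant `−d` exists (`stub_cubicFieldAP`)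
and the dictionary gives `3 ∣ h(−d)`. -/
theorem apD_mem_iqThreeSet
    (hH : ∀ X : ℕ, ∀ D ∈ negFundDiscrs X, quadFieldThreeTorsion D = 2 * cubicFieldCountOfDisc D + 1)
    {N : ℕ} (hN : Squarefree N)
    (k : ℕ) (hfund : IsNegFundamentalDiscr (N * (1 + 2 * N * k) * (27 * N * (1 + 2 * N * k) - 4))) :
    N * (1 + 2 * N * k) * (27 * N * (1 + 2 * N * k) - 4) ∈
      {d : ℕ | IsNegFundamentalDiscr d ∧ 3 ∣ BinaryQuadraticForm.classNumber (-(d : ℤ))} := by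
  refine ⟨hfund, ?_⟩
  have hc := stub_cubicFieldAP N k hN hfund
  have hd0 : N * (1 + 2 * N * k) * (27 * N * (1 + 2 * N * k) - 4) ≠ 0 := by
    intro h0
    rw [h0] at hfund
    exact not_isNegFundamentalDiscr_zero hfund
  exact three_dvd_classNumber_of_threeTorsion_dictionary hH hfund (by omega) hc

/-! ### The domination -/

/-- **`IQ3 ∈ P/poly → SQUAREFREES ∈ P/poly` (given Hasse's dictionary).** The one-sided randomized
reduction `SQF ≤ IQ3` of the line `Sketch` — sampler `stub_samplerAP` guarded by `stub_natAdapter`,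
exact NO side `stub_oneSidedAP`, YES-density `≥ 1/8` from `stub_fundDensityAP ∘ stub_apSieve`, hits
certified by `stub_cubicFieldAP` + the dictionary — fed to `mem_PPoly_of_rurReduction` with seed
length `ℓ(n) = 4n + 8` and success polynomial `32 X + 72`. -/
theorem toLanguage_squarefree_mem_PPoly_of_iqThree
    (hH : ∀ X : ℕ, ∀ D ∈ negFundDiscrs X, quadFieldThreeTorsion D = 2 * cubicFieldCountOfDisc D + 1)
    (hIQ : encodingNatBool.toLanguage
      {d : ℕ | IsNegFundamentalDiscr d ∧ 3 ∣ BinaryQuadraticForm.classNumber (-(d : ℤ))} ∈ PPoly) :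
    encodingNatBool.toLanguage {m : ℕ | Squarefree m} ∈ PPoly := by
  obtain ⟨f, hf, hfval⟩ := stub_samplerAP
  obtain ⟨f', hf', hcanon, hjunk⟩ := stub_natAdapter f hf []
  obtain ⟨n₀, hdens⟩ := stub_fundDensityAP stub_apSieve
  refine mem_PPoly_of_rurReduction (encodingNatBool.toLanguage {m : ℕ | Squarefree m})
    (encodingNatBool.toLanguage
      {d : ℕ | IsNegFundamentalDiscr d ∧ 3 ∣ BinaryQuadraticForm.classNumber (-(d : ℤ))})
    f' hf' (fun n => 4 * n + 8) (32 * Polynomial.X + 72) n₀ (fun n => ?_) ?_ ?_ hIQ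
  · simp only [Polynomial.eval_add, Polynomial.eval_mul, Polynomial.eval_ofNat, Polynomial.eval_X]
    omega
  · -- NO side (exact): non-squarefree numerals by `stub_oneSidedAP`, non-numerals by the guard
    intro x hx r
    by_cases hcx : ∃ m : ℕ, encodeNat m = x
    · obtain ⟨m, rfl⟩ := hcx
      have hm : ¬ Squarefree m := fun h =>
        hx ((encodeNat_mem_toLanguage_iff {m : ℕ | Squarefree m} m).2 h)
      rw [hcanon, hfval, bitsToNat_encodeNat, encodeNat_mem_toLanguage_iff]
      exact stub_oneSidedAP m (bitsToNat r) hm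
    · rw [hjunk x r (fun m hm => hcx ⟨m, hm⟩)]
      exact nil_not_mem_iqThreeLanguage
  · -- YES side (density ≥ 1/8), and fundamental seeds are in `S`
    intro x hx hn
    obtain ⟨N, hN, hNx⟩ := hx
    change encodeNat N = x at hNx
    subst hNx
    have hsq : Squarefree N := hN
    have h := hdens (encodeNat N).length hn N hsq rfl
    have hq : 8 ≤ (32 * Polynomial.X + 72 : Polynomial ℕ).eval (encodeNat N).length := by
      simp only [Polynomial.eval_add, Polynomial.eval_mul, Polynomial.eval_ofNat, Polynomial.eval_X]
      omega
    refine h.trans ((Nat.mul_le_mul_right _ hq).trans (Nat.mul_le_mul_left _ ?_))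
    rw [← card_filter_seeds (4 * (encodeNat N).length + 8) (fun k =>
      IsNegFundamentalDiscr (N * (1 + 2 * N * k) * (27 * N * (1 + 2 * N * k) - 4)))]
    refine Finset.card_le_card fun r hr => ?_
    rw [Finset.mem_filter] at hr ⊢
    refine ⟨Finset.mem_univ _, ?_⟩
    rw [hcanon, hfval, bitsToNat_encodeNat, encodeNat_mem_toLanguage_iff]
    exact apD_mem_iqThreeSet hH hsq _ hr.2

/-- **The crux from the apex: `SQUAREFREES ∉ P/poly → IqThreeNotPPoly`**, given Hasse's dictionary
(first hypothesis = verbatim `Literature.NumberTheory.CubicFields.Hasse1930_threeTorsion_dictionary_neg`,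
a published theorem resting on class field theory). CONDITIONAL theorem on the route decl, by name;
the apex "squarefreeness has no polynomial-size circuits" is hypothesis-type — Adleman–McCurley O8 —
and implies `FACT ∉ FP/poly`. -/
theorem iqThreeNotPPoly_of_squarefree_not_mem_PPoly :
    (∀ X : ℕ, ∀ D ∈ negFundDiscrs X, quadFieldThreeTorsion D = 2 * cubicFieldCountOfDisc D + 1) → encodingNatBool.toLanguage {m : ℕ | Squarefree m} ∉ PPoly → IqThreeNotPPoly :=
  fun hH hX hIQ => hX (toLanguage_squarefree_mem_PPoly_of_iqThree hH hIQ)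

/-- **The refutation floor**: a refutation of the crux (polynomial-size circuits for `IQ3`) yields
polynomial-size circuits for SQUAREFREENESS (given Hasse's dictionary). -/
theorem toLanguage_squarefree_mem_PPoly_of_not_iqThreeNotPPoly
    (hH : ∀ X : ℕ, ∀ D ∈ negFundDiscrs X, quadFieldThreeTorsion D = 2 * cubicFieldCountOfDisc D + 1) (h : ¬ IqThreeNotPPoly) :
    encodingNatBool.toLanguage {m : ℕ | Squarefree m} ∈ PPoly :=
  toLanguage_squarefree_mem_PPoly_of_iqThree hH (not_not.1 h)

end Summit.QuantumAdvantage.QuantumAdvantage.Theorems.IqThreeNotPPoly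

end
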